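import Summits.HodgeConjecture.CorCM.GaloisDicyclicNondegenerate
import Summits.HodgeConjecture.CorCM.CyclicCompositeCMTypes
import Summits.HodgeConjecture.CorCM.GaloisRankTableCertificates
import Literature.AlgebraicGeometry.Pohlmann1968.CMTypeRankCharactersNumberField
import HarnessLib

/-!
# Dicyclic Galois groups `Dic_n` with `n = 2^k m`, `m` odd and COMPOSITE: primitive degenerate CM types, simple
# degenerate CM abelian varieties of dimension `2n`, and the classification

COR-CM (cell `pub-hodgecm2`), binder seat b04 (gen 20), count-neutral claim DICYCLIC-TWO-SHEET, part V — the
sharpness companion of part IV (`CorCM/GaloisDicyclicNondegenerate`: `n = 2^k q` or `2^k` ⟹ every primitive CM type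
nondegenerate).  KERNEL ONLY: theorems; no definition, no named fact, no `sorry`.  `HC_CM` is neither used nor
claimed.

MECHANISM (the DOUBLE of a cyclic type).  For a CM half `T ⊆ ℤ/2n` of the cyclic subgroup `⟨a⟩ ⊆ Dic_n` (w.r.t.
`n ∈ ℤ/2n`) put `S = a(T) ⊔ a(T) x` (`x = xa 0`; `a j ∈ S ↔ j ∈ T`, `xa j ∈ S ↔ -j ∈ T`).  Then (§1) `S` is a CM set
for `c = a n`; (§2) its LEFT STABILISER is trivial as soon as the translates of `T` separate the points of `ℤ/2n`
(`a u` would give `u + T = T`, `xa u` would give `T + n = T`); (§3) if an ODD character of `ℤ/2n` vanishes on `T`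
(`T` degenerate, Kubota; a balanced non-symmetric weight `f`, Hazama), the weight `F(a j) = f(j)`, `F(xa j) = 0` is
balanced for `S` under right translations and not `c`-symmetric: `S` is DEGENERATE.  Gen 12's inflated block types
(`CyclicComposite.exists_primitive_degenerate`, cyclic of order `2^{k+1} m`, `m` odd composite) supply `T` (§4).

* §5 FIELD LEVEL: `K` Galois CM with `Gal(K/ℚ) ≅ Dic_n`, `n = 2^k m`, `m` odd composite ⟹ a PRIMITIVE DEGENERATE CM
  type (`exists_isPrimitive_not_isNondegenerate_dicyclic`, via gen 17's `GaloisTable.exists_isPrimitive_of_tableModel`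
  and part I's `isNondegenerate_iff_typeRank_op`) ⟹ a SIMPLE DEGENERATE abelian variety of dimension `2n` with CM by
  `K` carrying an exceptional Hodge class on some power (`exists_simple_degenerate_dicyclic`; Shimura's existence
  theorem, Hazama's converse).
* §6 **THE CLASSIFICATION FOR DICYCLIC GALOIS GROUPS** (`forall_isPrimitive/isSimple_isNondegenerate_iff_dicyclic`):
  `Gal(K/ℚ) ≅ Dic_n`, `n = 2^k m`, `m` odd — every simple abelian variety with CM by `K` is nondegenerate ⟺ `m = 1` or
  `m` prime (the exact analogue of the cyclic classification, gen 12).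

## References

* [Kubota1965] T. Kubota, Trans. AMS 118 (1965), §2, §4 Lemma 2.
* [Dodson1984] B. Dodson, *The structure of Galois groups of CM-fields*, Trans. AMS 283 (1984), §3.2.1.
* [Shimura1998] G. Shimura, *Abelian Varieties with Complex Multiplication and Modular Functions*, §6.2, §8.2.
* [Gordon1999HodgeAVSurvey] B. B. Gordon, *A survey of the Hodge conjecture for abelian varieties*, Thm. 6.4, §9.3–9.4.
-/

noncomputable section

open CategoryTheory CategoryTheory.Limits NumberField MulOpposite
open scoped BigOperators

namespace Summit.HodgeConjecture.CorCM.GaloisDicyclic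

open Literature.NumberTheory.ComplexMultiplication
open Literature.AlgebraicGeometry.Motives (AbelianVariety CMType)
open Literature.AlgebraicGeometry.HodgeTheory
open Literature.AlgebraicGeometry.ComplexMultiplication (IsCMTypeRealisation isSimple_iff_isPrimitive)
open Literature.AlgebraicGeometry.Pohlmann1968
open Literature.Barriers.HodgeConjecture (divisorClassesSpan)
open Summit.HodgeConjecture.CorCM.GaloisRank
open Summit.HodgeConjecture.CorCM.AbelianSixteen (exists_simple_realisation_of_isPrimitive)
open QuaternionGroup

/-! ## §1–§3 The double of a cyclic CM half -/

section Double

variable {n : ℕ} [NeZero n]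
variable {T : Finset (Multiplicative (ZMod (2 * n)))} {S : Finset (QuaternionGroup n)}

omit [NeZero n] in
/-- The double `S = a(T) ⊔ a(T)·x` of `T ⊆ ℤ/2n` exists as a finite set of `Dic_n`. [folklore] -/
theorem exists_double (T : Finset (Multiplicative (ZMod (2 * n)))) :
    ∃ S : Finset (QuaternionGroup n), (∀ j, a j ∈ S ↔ Multiplicative.ofAdd j ∈ T) ∧
      (∀ j, xa j ∈ S ↔ Multiplicative.ofAdd (-j) ∈ T) := by
  classical
  refine ⟨T.image (fun t => a (Multiplicative.toAdd t)) ∪ T.image (fun t => xa (-Multiplicative.toAdd t)),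
    fun j => ?_, fun j => ?_⟩
  · simp only [Finset.mem_union, Finset.mem_image]
    constructor
    · rintro (⟨t, ht, h⟩ | ⟨t, ht, h⟩)
      · have : Multiplicative.toAdd t = j := a.inj h
        rwa [← this, ofAdd_toAdd]
      · exact absurd h (by simp)
    · exact fun h => Or.inl ⟨Multiplicative.ofAdd j, h, rfl⟩
  · simp only [Finset.mem_union, Finset.mem_image]
    constructor
    · rintro (⟨t, ht, h⟩ | ⟨t, ht, h⟩)
      · exact absurd h (by simp)
      · have : -Multiplicative.toAdd t = j := xa.inj h
        rw [← this, neg_neg, ofAdd_toAdd]; exact ht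
    · exact fun h => Or.inr ⟨Multiplicative.ofAdd (-j), h, by simp⟩

omit [NeZero n] in
/-- **The double is a CM set for `c = a n`.** [cite: Shimura1998, §18.2 Lemma (i)] -/
theorem double_mul_mem_iff (hT : IsCMTypeWith (Multiplicative.ofAdd (n : ZMod (2 * n))) (↑T : Set (Multiplicative (ZMod (2 * n)))))
    (hSa : ∀ j, a j ∈ S ↔ Multiplicative.ofAdd j ∈ T) (hSx : ∀ j, xa j ∈ S ↔ Multiplicative.ofAdd (-j) ∈ T)
    (y : QuaternionGroup n) : a n * y ∈ S ↔ y ∉ S := by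
  have key : ∀ j : ZMod (2 * n), Multiplicative.ofAdd ((n : ZMod (2 * n)) + j) ∈ T ↔
      Multiplicative.ofAdd j ∉ T := fun j => by
    have h := hT.rho_smul_mem_iff (Multiplicative.ofAdd j)
    rw [smul_eq_mul, Finset.mem_coe, Finset.mem_coe] at h
    exact h
  rcases y with j | j
  · rw [a_mul_a, hSa, hSa, key]
  · rw [a_mul_xa, hSx, hSx, show -(j - (n : ZMod (2 * n))) = n + -j by ring, key]

omit [NeZero n] in
/-- `a n` is central in `Dic_n` (`n = -n` in `ℤ/2n`). [folklore] -/
theorem a_n_mul_comm (y : QuaternionGroup n) : a n * y = y * a n := by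
  have hnn : (n : ZMod (2 * n)) + n = 0 := by
    rw [← two_mul]
    exact_mod_cast ZMod.natCast_self (2 * n)
  rcases y with j | j
  · rw [a_mul_a, a_mul_a, add_comm]
  · rw [a_mul_xa, xa_mul_a, sub_eq_add_neg, neg_eq_of_add_eq_zero_left hnn]

/-- **Trivial left stabiliser**: if the translates of `T` separate the points of `ℤ/2n` then no `v ≠ 1` satisfies
`v S = S`. [cite: Shimura1998, §8.2 Prop. 26] -/
theorem double_leftStabiliser (hT : IsCMTypeWith (Multiplicative.ofAdd (n : ZMod (2 * n))) (↑T : Set (Multiplicative (ZMod (2 * n)))))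
    (hsep : ∀ x y : Multiplicative (ZMod (2 * n)), (∀ g, g * x ∈ T ↔ g * y ∈ T) → x = y)
    (hSa : ∀ j, a j ∈ S ↔ Multiplicative.ofAdd j ∈ T) (hSx : ∀ j, xa j ∈ S ↔ Multiplicative.ofAdd (-j) ∈ T)
    (v : QuaternionGroup n) (hv : v ≠ 1) : ∃ w : QuaternionGroup n, ¬ (w ∈ S ↔ v * w ∈ S) := by
  by_contra hall
  push Not at hall
  rcases v with u | u
  · -- `a u`: `u + T = T`, so `u = 0` by separation
    apply hv
    have h1 : Multiplicative.ofAdd u = 1 := by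
      refine (hsep 1 (Multiplicative.ofAdd u) fun g => ?_).symm
      have h := hall (a (Multiplicative.toAdd g))
      rw [a_mul_a, hSa, hSa, ofAdd_toAdd] at h
      rw [mul_one, h]
      change Multiplicative.ofAdd (u + Multiplicative.toAdd g) ∈ T ↔ Multiplicative.ofAdd (Multiplicative.toAdd g + u) ∈ T
      rw [add_comm]
    rw [one_def]
    exact congrArg a (show u = 0 from ofAdd_eq_one.1 h1)
  · -- `xa u`: `1 ∈ T ↔ -u ∈ T ↔ n ∈ T`, contradicting the CM condition
    have h1 := hall (a 0)
    rw [xa_mul_a, add_zero, hSa, hSx] at h1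
    have h2 := hall (xa u)
    rw [xa_mul_xa, add_sub_cancel_right, hSx, hSa] at h2
    have h3 := hT.rho_smul_mem_iff (Multiplicative.ofAdd (0 : ZMod (2 * n)))
    rw [smul_eq_mul, Finset.mem_coe, Finset.mem_coe] at h3
    change Multiplicative.ofAdd ((n : ZMod (2 * n)) + 0) ∈ T ↔ _ at h3
    rw [add_zero] at h3
    exact iff_not_self ((h1.trans h2).trans h3)

/-- **Degenerate**: if an ODD character of `ℤ/2n` vanishes on `T`, the double `S` is degenerate for the
right-translation action of `Dic_n`: `typeRank Dic_nᵐᵒᵖ S ≠ 2n + 1`. [cite: Kubota1965, §4 Lemma 2]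
[cite: Gordon1999HodgeAVSurvey, §9.3] -/
theorem double_typeRank_ne (hT : IsCMTypeWith (Multiplicative.ofAdd (n : ZMod (2 * n))) (↑T : Set (Multiplicative (ZMod (2 * n)))))
    (hχ : ∃ χ : AddChar (Additive (Multiplicative (ZMod (2 * n)))) ℂ,
      χ (Additive.ofMul (Multiplicative.ofAdd (n : ZMod (2 * n)))) = -1 ∧ ∑ t ∈ T, χ (Additive.ofMul t) = 0)
    (hSa : ∀ j, a j ∈ S ↔ Multiplicative.ofAdd j ∈ T) (hSx : ∀ j, xa j ∈ S ↔ Multiplicative.ofAdd (-j) ∈ T) :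
    typeRank (QuaternionGroup n)ᵐᵒᵖ (↑S : Set (QuaternionGroup n)) ≠
      Fintype.card (QuaternionGroup n) / 2 + 1 := by
  classical
  -- `T` is degenerate: a balanced `ℕ`-weight `f` which is not symmetric
  have hTdeg : ¬ typeRank (Multiplicative (ZMod (2 * n))) (↑T : Set (Multiplicative (ZMod (2 * n)))) =
      Fintype.card (Multiplicative (ZMod (2 * n))) / 2 + 1 := by
    rw [hT.typeRank_eq_iff_forall_oddCharacters]
    push Not
    exact hχ
  rw [hT.typeRank_eq_iff_forall_nat_symm] at hTdeg
  push Not at hTdeg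
  obtain ⟨f, hf, x₀, hx₀⟩ := hTdeg
  -- the abstract CM structure of `S` for `op (a n)`
  have hcm : IsCMTypeWith (op (a (n : ZMod (2 * n)) : QuaternionGroup n)) (↑S : Set (QuaternionGroup n)) := by
    refine ⟨fun y => ?_, fun g y => ?_, fun y => ?_⟩
    · rw [Finset.mem_coe, Finset.mem_coe, op_smul_eq_mul, ← a_n_mul_comm, double_mul_mem_iff hT hSa hSx, not_not]
    · simp only [MulOpposite.smul_eq_mul_unop, unop_op]
      rw [mul_assoc, mul_assoc, ← a_n_mul_comm]
    · have hnn : (n : ZMod (2 * n)) + n = 0 := by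
        rw [← two_mul]
        exact_mod_cast ZMod.natCast_self (2 * n)
      rw [op_smul_eq_mul, op_smul_eq_mul, mul_assoc, a_mul_a, hnn, ← one_def, mul_one]
  intro hrank
  -- the weight `F(a j) = f(j)`, `F(xa j) = 0`
  let F : QuaternionGroup n → ℕ := fun y => match y with
    | a j => f (Multiplicative.ofAdd j)
    | xa _ => 0
  -- sums over `Dic_n` split into the two sheets
  have hsum : ∀ h : QuaternionGroup n → ℚ, ∑ y, h y = ∑ j : ZMod (2 * n), h (a j) + ∑ j : ZMod (2 * n), h (xa j) := by
    intro h
    have hbij : Function.Bijective (Sum.elim a xa : ZMod (2 * n) ⊕ ZMod (2 * n) → QuaternionGroup n) := by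
      constructor
      · rintro (j | j) (j' | j') hjj' <;> simp_all
      · rintro (j | j)
        · exact ⟨Sum.inl j, rfl⟩
        · exact ⟨Sum.inr j, rfl⟩
    have e := Fintype.sum_bijective _ hbij (fun p => h (Sum.elim a xa p)) h fun _ => rfl
    rw [← e, Fintype.sum_sum_type]
    simp only [Sum.elim_inl, Sum.elim_inr]
  have hbal : IsBalanced (QuaternionGroup n)ᵐᵒᵖ (↑S : Set (QuaternionGroup n)) fun y => (F y : ℚ) := by
    intro g
    rw [← op_unop g]
    rcases unop g with u | u
    · -- right translation by `a u` ↔ translation by `u` on `T`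
      have h := hf (Multiplicative.ofAdd u)
      rw [hsum, hsum]
      have e1 : ∀ j : ZMod (2 * n), (F (a j) : ℚ) * translateInd (↑S : Set (QuaternionGroup n)) (op (a u)) (a j) =
          (f (Multiplicative.ofAdd j) : ℚ) * translateInd (↑T : Set (Multiplicative (ZMod (2 * n)))) (Multiplicative.ofAdd u)
            (Multiplicative.ofAdd j) := fun j => by
        have hiff : op (a u) • a j ∈ (↑S : Set (QuaternionGroup n)) ↔
            Multiplicative.ofAdd u • Multiplicative.ofAdd j ∈ (↑T : Set (Multiplicative (ZMod (2 * n)))) := by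
          rw [op_smul_eq_mul, a_mul_a, Finset.mem_coe, hSa, smul_eq_mul, Finset.mem_coe, ofAdd_add,
            mul_comm (Multiplicative.ofAdd j) (Multiplicative.ofAdd u)]
        by_cases hm : op (a u) • a j ∈ (↑S : Set (QuaternionGroup n))
        · rw [translateInd_of_mem hm, translateInd_of_mem (hiff.1 hm)]
        · rw [translateInd_of_not_mem hm, translateInd_of_not_mem (fun h' => hm (hiff.2 h'))]
      have e2 : ∀ j : ZMod (2 * n), (F (xa j) : ℚ) * translateInd (↑S : Set (QuaternionGroup n)) (op (a u)) (xa j) =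
          0 := fun j => by simp [F]
      simp_rw [e1, e2, Finset.sum_const_zero, add_zero]
      have e3 : ∑ j : ZMod (2 * n), (f (Multiplicative.ofAdd j) : ℚ) * translateInd (↑T : Set (Multiplicative (ZMod (2 * n))))
          (Multiplicative.ofAdd u) (Multiplicative.ofAdd j) =
          ∑ x : Multiplicative (ZMod (2 * n)), (f x : ℚ) * translateInd (↑T : Set (Multiplicative (ZMod (2 * n)))) (Multiplicative.ofAdd u) x :=
        Fintype.sum_equiv Multiplicative.ofAdd _ _ fun _ => rfl
      have e4 : ∑ j : ZMod (2 * n), (F (a j) : ℚ) = ∑ x : Multiplicative (ZMod (2 * n)), (f x : ℚ) :=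
        Fintype.sum_equiv Multiplicative.ofAdd _ _ fun _ => rfl
      have e5 : ∑ j : ZMod (2 * n), (F (xa j) : ℚ) = 0 := by simp [F]
      rw [e3, e4, e5, add_zero]
      exact h
    · -- right translation by `xa u` ↔ translation by `-u` on `T`
      have h := hf (Multiplicative.ofAdd (-u))
      rw [hsum, hsum]
      have e1 : ∀ j : ZMod (2 * n), (F (a j) : ℚ) * translateInd (↑S : Set (QuaternionGroup n)) (op (xa u)) (a j) =
          (f (Multiplicative.ofAdd j) : ℚ) * translateInd (↑T : Set (Multiplicative (ZMod (2 * n)))) (Multiplicative.ofAdd (-u))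
            (Multiplicative.ofAdd j) := fun j => by
        have hiff : op (xa u) • a j ∈ (↑S : Set (QuaternionGroup n)) ↔
            Multiplicative.ofAdd (-u) • Multiplicative.ofAdd j ∈ (↑T : Set (Multiplicative (ZMod (2 * n)))) := by
          rw [op_smul_eq_mul, a_mul_xa, Finset.mem_coe, hSx, smul_eq_mul, Finset.mem_coe,
            show -(u - j) = -u + j by ring, ofAdd_add]
        by_cases hm : op (xa u) • a j ∈ (↑S : Set (QuaternionGroup n))
        · rw [translateInd_of_mem hm, translateInd_of_mem (hiff.1 hm)]
        · rw [translateInd_of_not_mem hm, translateInd_of_not_mem (fun h' => hm (hiff.2 h'))]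
      have e2 : ∀ j : ZMod (2 * n), (F (xa j) : ℚ) * translateInd (↑S : Set (QuaternionGroup n)) (op (xa u)) (xa j) =
          0 := fun j => by simp [F]
      simp_rw [e1, e2, Finset.sum_const_zero, add_zero]
      have e3 : ∑ j : ZMod (2 * n), (f (Multiplicative.ofAdd j) : ℚ) * translateInd (↑T : Set (Multiplicative (ZMod (2 * n))))
          (Multiplicative.ofAdd (-u)) (Multiplicative.ofAdd j) =
          ∑ x : Multiplicative (ZMod (2 * n)), (f x : ℚ) * translateInd (↑T : Set (Multiplicative (ZMod (2 * n)))) (Multiplicative.ofAdd (-u)) x :=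
        Fintype.sum_equiv Multiplicative.ofAdd _ _ fun _ => rfl
      have e4 : ∑ j : ZMod (2 * n), (F (a j) : ℚ) = ∑ x : Multiplicative (ZMod (2 * n)), (f x : ℚ) :=
        Fintype.sum_equiv Multiplicative.ofAdd _ _ fun _ => rfl
      have e5 : ∑ j : ZMod (2 * n), (F (xa j) : ℚ) = 0 := by simp [F]
      rw [e3, e4, e5, add_zero]
      exact h
  -- nondegeneracy would make `F` symmetric under `c`, but `f` is not
  have hsym := hcm.symm_of_isBalanced_of_typeRank_eq hrank hbal (a (Multiplicative.toAdd x₀))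
  apply hx₀
  have h1 : F (op (a (n : ZMod (2 * n))) • a (Multiplicative.toAdd x₀)) =
      f (Multiplicative.ofAdd (n : ZMod (2 * n)) • x₀) := by
    rw [op_smul_eq_mul, a_mul_a, smul_eq_mul]
    change f (Multiplicative.ofAdd (Multiplicative.toAdd x₀ + n)) = f (Multiplicative.ofAdd (n : ZMod (2 * n)) * x₀)
    rw [add_comm, ofAdd_add, ofAdd_toAdd]
  have h2 : F (a (Multiplicative.toAdd x₀)) = f x₀ := by
    change f (Multiplicative.ofAdd (Multiplicative.toAdd x₀)) = f x₀
    rw [ofAdd_toAdd]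
  have h3 : F (op (a (n : ZMod (2 * n))) • a (Multiplicative.toAdd x₀)) = F (a (Multiplicative.toAdd x₀)) := by
    exact_mod_cast hsym
  rw [h1, h2] at h3
  exact h3

end Double

/-! ## §4 Existence for `n = 2^k m`, `m` odd composite -/

section Exist

variable {n : ℕ} [NeZero n]

/-- **`Dic_n`, `n = 2^k m`, `m` odd with a divisor `1 < l < m`: a CM set with trivial left stabiliser which is
degenerate for the right-translation action** (the double of gen 12's inflated block type of `ℤ/2^{k+1} m`).
[cite: Dodson1984, §3.2.1] [cite: Kubota1965, §4 Lemma 2] -/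
theorem exists_cm_leftStabiliser_trivial_typeRank_ne {k m l : ℕ} (hn : n = 2 ^ k * m) (hm : Odd m) (hlm : l ∣ m)
    (h2l : 2 ≤ l) (hl : l < m) :
    ∃ S : Finset (QuaternionGroup n), (∀ y, a n * y ∈ S ↔ y ∉ S) ∧
      (∀ v : QuaternionGroup n, v ≠ 1 → ∃ w, ¬ (w ∈ S ↔ v * w ∈ S)) ∧
      typeRank (QuaternionGroup n)ᵐᵒᵖ (↑S : Set (QuaternionGroup n)) ≠ Fintype.card (QuaternionGroup n) / 2 + 1 := by
  have hγ : orderOf (Multiplicative.ofAdd (1 : ZMod (2 * n))) = 2 ^ (k + 1) * m := by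
    rw [orderOf_ofAdd_one, hn]; ring
  obtain ⟨T, hT, hχ, hsep⟩ := CyclicComposite.exists_primitive_degenerate hγ mem_powers_ofAdd_one hm hlm h2l hl
  have hρ : Multiplicative.ofAdd (1 : ZMod (2 * n)) ^ (2 ^ k * m) = Multiplicative.ofAdd (n : ZMod (2 * n)) := by
    rw [← ofAdd_nsmul, Nat.smul_one_eq_cast, ← hn]
  rw [hρ] at hT hχ
  obtain ⟨S, hSa, hSx⟩ := exists_double T
  exact ⟨S, double_mul_mem_iff hT hSa hSx, double_leftStabiliser hT hsep hSa hSx, double_typeRank_ne hT hχ hSa hSx⟩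

end Exist

/-! ## §5 Field level: primitive degenerate types and simple degenerate abelian varieties -/

section Field

variable {n : ℕ} [NeZero n]
variable {K : Type} [Field K] [NumberField K] [IsCMField K] [IsGalois ℚ K]

/-- **`Gal(K/ℚ) ≅ Dic_n`, `n = 2^k m`, `m` odd with a divisor `1 < l < m` ⟹ a PRIMITIVE DEGENERATE CM type of `K`.**
[cite: Shimura1998, §8.2 Prop. 26] [cite: Kubota1965, §4 Lemma 2] [cite: Dodson1984, §3.2.1] -/
theorem exists_isPrimitive_not_isNondegenerate_dicyclic {k m l : ℕ} (hn : n = 2 ^ k * m) (hm : Odd m)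
    (hlm : l ∣ m) (h2l : 2 ≤ l) (hl : l < m) (e : (K ≃ₐ[ℚ] K) ≃* QuaternionGroup n) (φ₀ : K →+* ℂ) :
    ∃ Φ : CMType K, IsPrimitive (ℂ ≃+* ℂ) Φ.1 φ₀ ∧ ¬ IsNondegenerate Φ := by
  obtain ⟨S, hcm, hstab, hrank⟩ := exists_cm_leftStabiliser_trivial_typeRank_ne (n := n) hn hm hlm h2l hl
  obtain ⟨Φ, hprim, hS⟩ := GaloisTable.exists_isPrimitive_of_tableModel (K := K) (X := QuaternionGroup n)
    (fun y z => y * z) e.toEquiv (fun _ _ => map_mul e _ _) (a n) (map_complexConj_eq_a e) 1 (map_one e) S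
    (fun y => by rw [hcm, not_not]) hstab φ₀
  refine ⟨Φ, hprim, fun hnd => hrank ?_⟩
  exact (isNondegenerate_iff_typeRank_op e Φ φ₀ S (fun y => hS y)).1 hnd

/-- **… realised: a SIMPLE DEGENERATE abelian variety of dimension `2n` with CM by `K`**, carrying on some power a
rational `(p,p)` class outside the complexified divisor ring (Shimura's existence theorem; Hazama's converse).
[cite: Shimura1998, §6.2 Thm. 3 and §8.2 Prop. 26] [cite: Gordon1999HodgeAVSurvey, Thm. 6.4] -/
theorem exists_simple_degenerate_dicyclic {k m l : ℕ} (hn : n = 2 ^ k * m) (hm : Odd m) (hlm : l ∣ m)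
    (h2l : 2 ≤ l) (hl : l < m) (e : (K ≃ₐ[ℚ] K) ≃* QuaternionGroup n) :
    ∃ (Φ : CMType K) (φ₀ : K →+* ℂ) (A : AbelianVariety ℂ) (ι : 𝓞 K →+* End A)
      (θ : K →+* Module.End ℂ (complexBetti A.X 1)),
      IsPrimitive (ℂ ≃+* ℂ) Φ.1 φ₀ ∧ ¬ IsNondegenerate Φ ∧ IsCMTypeRealisation Φ A ι θ ∧ A.IsSimple ∧
      A.dim = 2 * n ∧
      ∃ N p : ℕ, ∃ x : complexBetti (⨁ fun _ : Fin N => A).X (2 * p), IsRationalClass x ∧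
        IsOfHodgeType (⨁ fun _ : Fin N => A).dim (⨁ fun _ : Fin N => A).X (2 * p) p p x ∧
        x ∉ divisorClassesSpan (⨁ fun _ : Fin N => A).X (⨁ fun _ : Fin N => A).dim p := by
  obtain ⟨φ₀⟩ := (inferInstance : Nonempty (K →+* ℂ))
  obtain ⟨Φ, hprim, hdeg⟩ := exists_isPrimitive_not_isNondegenerate_dicyclic hn hm hlm h2l hl e φ₀
  obtain ⟨A, ι, θ, hA, hs, hdim⟩ := exists_simple_realisation_of_isPrimitive Φ φ₀ hprim
  refine ⟨Φ, φ₀, A, ι, θ, hprim, hdeg, hA, hs, ?_, exists_exceptional_pow_of_not_isNondegenerate φ₀ hprim hdeg hA⟩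
  rw [hdim, finrank_eq_four_mul e]; omega

/-! ## §6 The classification for dicyclic Galois groups -/

omit [IsGalois ℚ K] in
/-- An odd number is not `2`. [folklore] -/
private theorem ne_two_of_odd' {m : ℕ} (hm : Odd m) : m ≠ 2 := by
  obtain ⟨j, rfl⟩ := hm
  omega

/-- **THE CLASSIFICATION.**  `K` Galois CM with `Gal(K/ℚ) ≅ Dic_n`, `n = 2^k m`, `m` odd: every PRIMITIVE CM type
of `K` is NONDEGENERATE ⟺ `m = 1` or `m` is prime (⇐: part IV; ⇒: §5).  The exact analogue of the cyclic
classification `Gal ≅ ℤ/2^{k+1} m`. [cite: Kubota1965, §4 Lemma 2] [cite: Shimura1998, §8.2 Prop. 26]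
[cite: Dodson1984, §3.2.1] -/
theorem forall_isPrimitive_isNondegenerate_iff_dicyclic {k m : ℕ} (hn : n = 2 ^ k * m) (hm : Odd m)
    (e : (K ≃ₐ[ℚ] K) ≃* QuaternionGroup n) :
    (∀ (Φ : CMType K) (φ₀ : K →+* ℂ), IsPrimitive (ℂ ≃+* ℂ) Φ.1 φ₀ → IsNondegenerate Φ) ↔ (m = 1 ∨ m.Prime) := by
  constructor
  · intro h
    by_contra hnot
    rw [not_or] at hnot
    have h2m : 2 ≤ m := by
      obtain ⟨j, hj⟩ := hm
      omega
    obtain ⟨l, hlm, h2l, hl⟩ := (Nat.not_prime_iff_exists_dvd_lt h2m).1 hnot.2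
    obtain ⟨φ₀⟩ := (inferInstance : Nonempty (K →+* ℂ))
    obtain ⟨Φ, hprim, hdeg⟩ := exists_isPrimitive_not_isNondegenerate_dicyclic hn hm hlm h2l hl e φ₀
    exact hdeg (h Φ φ₀ hprim)
  · rintro (rfl | hp) Φ φ₀ hprim
    · exact isNondegenerate_quaternion (k := k) (by rw [hn, mul_one]) e Φ
    · exact isNondegenerate_of_isPrimitive_dicyclic hn hp (ne_two_of_odd' hm) e φ₀ hprim

/-- **The classification on abelian varieties**: every SIMPLE abelian variety with complex multiplication by `K`
(`Gal(K/ℚ) ≅ Dic_n`, `n = 2^k m`, `m` odd) is NONDEGENERATE — hence satisfies the Hodge conjecture with all its powers —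
iff `m = 1` or `m` is prime; otherwise simple DEGENERATE ones of dimension `2n` exist. [cite: Gordon1999HodgeAVSurvey, Thm. 6.4]
[cite: Shimura1998, §6.2 Thm. 3, §8.2 Prop. 26] -/
theorem forall_isSimple_isNondegenerate_iff_dicyclic {k m : ℕ} (hn : n = 2 ^ k * m) (hm : Odd m)
    (e : (K ≃ₐ[ℚ] K) ≃* QuaternionGroup n) :
    (∀ (Φ : CMType K) (A : AbelianVariety ℂ) (ι : 𝓞 K →+* End A) (θ : K →+* Module.End ℂ (complexBetti A.X 1)),
      IsCMTypeRealisation Φ A ι θ → A.IsSimple → IsNondegenerate Φ) ↔ (m = 1 ∨ m.Prime) := by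
  rw [← forall_isPrimitive_isNondegenerate_iff_dicyclic hn hm e]
  constructor
  · intro h Φ φ₀ hprim
    obtain ⟨A, ι, θ, hA, hs, -⟩ := exists_simple_realisation_of_isPrimitive Φ φ₀ hprim
    exact h Φ A ι θ hA hs
  · intro h Φ A ι θ hA hs
    obtain ⟨φ₀⟩ := (inferInstance : Nonempty (K →+* ℂ))
    exact h Φ φ₀ ((isSimple_iff_isPrimitive hA φ₀).1 hs)

/-- **Dichotomy display**: either the Hodge conjecture holds for all powers of every simple abelian variety with CM by
`K`, or a simple degenerate one (with an exceptional Hodge class on a power) exists — according as the odd part of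
`n` is in `{1} ∪ primes` or not. [cite: Gordon1999HodgeAVSurvey, Thm. 6.4] -/
theorem hodgeConjectureFor_pow_or_exists_simple_degenerate_dicyclic {k m : ℕ} (hn : n = 2 ^ k * m) (hm : Odd m)
    (e : (K ≃ₐ[ℚ] K) ≃* QuaternionGroup n) :
    (∀ (Φ : CMType K) (A : AbelianVariety ℂ) (ι : 𝓞 K →+* End A) (θ : K →+* Module.End ℂ (complexBetti A.X 1)),
      IsCMTypeRealisation Φ A ι θ → A.IsSimple → ∀ N : ℕ,
        HodgeConjectureFor (⨁ fun _ : Fin N => A).dim (⨁ fun _ : Fin N => A).X) ∨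
    (∃ (Φ : CMType K) (φ₀ : K →+* ℂ) (A : AbelianVariety ℂ) (ι : 𝓞 K →+* End A)
      (θ : K →+* Module.End ℂ (complexBetti A.X 1)),
      IsPrimitive (ℂ ≃+* ℂ) Φ.1 φ₀ ∧ ¬ IsNondegenerate Φ ∧ IsCMTypeRealisation Φ A ι θ ∧ A.IsSimple ∧
      A.dim = 2 * n) := by
  by_cases hgood : m = 1 ∨ m.Prime
  · left
    intro Φ A ι θ hA hs N
    exact ((forall_isSimple_isNondegenerate_iff_dicyclic hn hm e).2 hgood Φ A ι θ hA hs).hodgeConjectureFor_pow hA N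
  · right
    rw [not_or] at hgood
    have h2m : 2 ≤ m := by
      obtain ⟨j, hj⟩ := hm
      omega
    obtain ⟨l, hlm, h2l, hl⟩ := (Nat.not_prime_iff_exists_dvd_lt h2m).1 hgood.2
    obtain ⟨Φ, φ₀, A, ι, θ, hprim, hdeg, hA, hs, hdim, -⟩ := exists_simple_degenerate_dicyclic hn hm hlm h2l hl e
    exact ⟨Φ, φ₀, A, ι, θ, hprim, hdeg, hA, hs, hdim⟩

end Field

end Summit.HodgeConjecture.CorCM.GaloisDicyclic

end
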